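import Summits.ResolutionOfSingularities.ResolutionOfSingularities.Theorems.WeightedInvariantHypersurfaceLocalGameEFTDimTwoNewton
import HarnessLib

/-!
# Abramovich–Quek–Schober at a height-two point, I: the rational-slope weighted filtration `𝒥ₙ((x, y); (q, r))`

Topic: `Summits/ResolutionOfSingularities/ResolutionOfSingularities/Theorems`. Helper for the door item
`HypersurfaceCentreConstruction` (statement `stmt-ResolutionOfSingularities-19897`, route `WeightedInvariant`), line
`local-engine`, ORDER (o25) «F-AQS-T in the kernel» of `res-L1-w43-plan-1` (2026-08-27T09:19:49Z): discharge of the named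
fact `AbramovichQuekSchober2025_heightTwoCentre` (`Literature/…/HypersurfaceHeightTwoWeightedCentre.lean`), piece (α1) of
the design memo `plan/tools/res-type-092/o25/O25-DESIGN.md` (res-type-092).

[OURS · L1 W4.3] Folklore bookkeeping for Abramovich–Quek–Schober, arXiv:2507.01232, Def. 3.2–3.3 / Thm 3.5: the admissible
centres `J = (y^{a₁}, x^{a₂})` with RATIONAL slope `a₂/a₁ = r/q` are recorded, in the tree's currency, by the weighted monomial
ideals `𝒥ₙ := weightedMonomialIdeal ![x, y] ![q, r] n` (`x ↦ q`, `y ↦ r`; «`δ_y ≥ r/q` iff `f ∈ 𝒥_{rν}`»).  NOT a statement of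
the manuscript under review (Hironaka 2017); nothing here is a claim about resolution of singularities.  AI work, weaker than
expert review.  Def-free.

## Content (`S` a commutative ring, mostly local with `(x, y) = 𝔪`)

* `weight_two`, `monomial_mem` — two-variable bookkeeping (`prod_two` is `LocalGameEFTNewton.prod_two`);
* `maximalIdeal_le`, `maximalIdeal_pow_le` — `𝔪 ⊆ 𝒥_q`, `𝔪^t ⊆ 𝒥_{qt}` when `q ≤ r`;
* `le_of_fst_mem` / `eq_of_fst` — the filtration does not see the transversal parameter `x` (`q ≤ r`);
* `eq_of_snd_unit_mul` — nor a unit factor on `y`;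
* `eq_of_snd_eq_unit_mul_add` — SUBSTITUTION: `y' = a·y + h`, `a` a unit, `h ∈ 𝔪^t`, `r ≤ q t` ⇒ same filtration;
* `slope_antitone` — at the `y^ν` corner the level-`rν` piece grows as the slope `r/q` decreases;
* `le_pow_of_weights_le` — `𝒥_{νW+1} ⊆ 𝔪^{ν+1}` when all weights are `≤ W`;
* `le_span_pow_sup_of_lt` — `𝒥_{r'ν}((x,y');(q',r')) ⊆ (y'^ν) + 𝒥_{bν+1}((x,y');(1,b))` when `r'/q' > b`
  (with `b = 1`: `⊆ (y'^ν) + 𝔪^{ν+1}`, the tangent line);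
* `le_span_sup_pow_cdiv`, `le_span_pow_sup_iSup` — the pieces read modulo `(y)` (inputs of the `S/(y)` comparison, file II;
  `⌈a/q⌉` is spelled `(a + q - 1) / q`, cf. `Literature.Analysis.Convolution.le_mul_ceilDiv`).

## References

* D. Abramovich, M. H. Quek, B. Schober, arXiv:2507.01232v3, Def. 3.2–3.3, Rem. 3.4, Thm 3.5. [AbramovichQuekSchober2025]
* J. Włodarczyk, *Functorial resolution by torus actions*, arXiv:2203.03090, Lemma 2.1.12. [Wlodarczyk2022]
-/

noncomputable section

open IsLocalRing Literature.AlgebraicGeometry.Resolution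

set_option linter.dupNamespace false -- mandated namespace of this single-conjunct summit

namespace Summit.ResolutionOfSingularities.ResolutionOfSingularities.Theorems

namespace AQSHeightTwo

universe u

variable {S : Type u} [CommRing S]

/-! ### Two-variable bookkeeping -/

/-- `Σᵢ ![q, r]ᵢ αᵢ = q α₀ + r α₁`. [folklore] -/
theorem weight_two (q r : ℕ) (α : Fin 2 → ℕ) : ∑ i, ![q, r] i * α i = q * α 0 + r * α 1 := by
  rw [Fin.sum_univ_two]; rfl

/-- The monomial `x^i y^j` of weight `q i + r j ≥ n` lies in `𝒥ₙ`. [cite: Wlodarczyk2022, Lemma 2.1.12] -/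
theorem monomial_mem (x y : S) (q r : ℕ) {i j n : ℕ} (h : n ≤ q * i + r * j) :
    x ^ i * y ^ j ∈ weightedMonomialIdeal ![x, y] ![q, r] n := by
  have := prod_pow_mem_weightedMonomialIdeal ![x, y] ![q, r] (n := n) ![i, j]
    (by rw [weight_two]; exact h)
  rwa [LocalGameEFTNewton.prod_two] at this

/-- Membership of a generator, unfolded: `z ∈ 𝒥ₙ` is generated by the `x^{α₀} y^{α₁}` with `q α₀ + r α₁ ≥ n`. [folklore] -/
theorem weightedMonomialIdeal_two_eq (x y : S) (q r n : ℕ) :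
    weightedMonomialIdeal ![x, y] ![q, r] n =
      Ideal.span {z | ∃ α : Fin 2 → ℕ, n ≤ q * α 0 + r * α 1 ∧ z = x ^ α 0 * y ^ α 1} := by
  rw [weightedMonomialIdeal]
  congr 1
  ext z
  simp only [Set.mem_setOf_eq, weight_two, LocalGameEFTNewton.prod_two]

/-- Induction principle on generators: to bound `𝒥ₙ` by an ideal it suffices to bound the monomials. [folklore] -/
theorem weightedMonomialIdeal_two_le {x y : S} {q r n : ℕ} {I : Ideal S}
    (h : ∀ i j : ℕ, n ≤ q * i + r * j → x ^ i * y ^ j ∈ I) :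
    weightedMonomialIdeal ![x, y] ![q, r] n ≤ I := by
  rw [weightedMonomialIdeal_two_eq, Ideal.span_le]
  rintro _ ⟨α, hα, rfl⟩
  exact h (α 0) (α 1) hα

/-! ### `𝔪 ⊆ 𝒥_q` and `𝔪^t ⊆ 𝒥_{qt}` -/

section Local

variable [IsLocalRing S]

/-- With `(x, y) = 𝔪` and `q ≤ r`: `𝔪 ⊆ 𝒥_q` (both generators have weight `≥ q`). [cite: Wlodarczyk2022, Lemma 2.1.12] -/
theorem maximalIdeal_le {x y : S} (hxy : Ideal.span {x, y} = maximalIdeal S) {q r : ℕ} (hqr : q ≤ r) :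
    maximalIdeal S ≤ weightedMonomialIdeal ![x, y] ![q, r] q := by
  rw [← hxy, Ideal.span_le, Set.insert_subset_iff, Set.singleton_subset_iff]
  refine ⟨?_, ?_⟩
  · simpa using monomial_mem x y q r (i := 1) (j := 0) (n := q) (by simp)
  · simpa using monomial_mem x y q r (i := 0) (j := 1) (n := q) (by simpa using hqr)

/-- With `(x, y) = 𝔪` and `q ≤ r`: `𝔪^t ⊆ 𝒥_{qt}`. [cite: Wlodarczyk2022, Lemma 2.1.12] -/
theorem maximalIdeal_pow_le {x y : S} (hxy : Ideal.span {x, y} = maximalIdeal S) {q r : ℕ} (hqr : q ≤ r) (t : ℕ) :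
    maximalIdeal S ^ t ≤ weightedMonomialIdeal ![x, y] ![q, r] (q * t) := by
  induction t with
  | zero => rw [pow_zero, Nat.mul_zero, weightedMonomialIdeal_zero, Ideal.one_eq_top]
  | succ t ih =>
    rw [pow_succ, Nat.mul_succ]
    exact (Ideal.mul_mono ih (maximalIdeal_le hxy hqr)).trans (weightedMonomialIdeal_mul_le ![x, y] ![q, r] _ _)

/-- A multiple of `𝔪^t` lies in `𝒥ₙ` as soon as `n ≤ q t` (`q ≤ r`). [folklore] -/
theorem mem_of_mem_maximalIdeal_pow {x y : S} (hxy : Ideal.span {x, y} = maximalIdeal S) {q r : ℕ} (hqr : q ≤ r)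
    {t n : ℕ} (hn : n ≤ q * t) {h : S} (hh : h ∈ maximalIdeal S ^ t) :
    h ∈ weightedMonomialIdeal ![x, y] ![q, r] n :=
  weightedMonomialIdeal_antitone _ _ hn (maximalIdeal_pow_le hxy hqr t hh)

/-! ### Independence of the transversal parameter and of unit factors; substitution -/

/-- **The filtration does not see `x`** (one inclusion): if `(x, y) = 𝔪`, `q ≤ r` and `x' ∈ 𝔪`, then
`𝒥ₙ((x', y); (q, r)) ⊆ 𝒥ₙ((x, y); (q, r))`. [cite: AbramovichQuekSchober2025, Rem. 3.4] -/
theorem le_of_fst_mem {x y x' : S} (hxy : Ideal.span {x, y} = maximalIdeal S) {q r : ℕ} (hqr : q ≤ r)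
    (hx' : x' ∈ maximalIdeal S) (n : ℕ) :
    weightedMonomialIdeal ![x', y] ![q, r] n ≤ weightedMonomialIdeal ![x, y] ![q, r] n := by
  refine weightedMonomialIdeal_le_of_forall_mem ![x, y] ![x', y] ![q, r] (Fin.forall_fin_two.2 ⟨?_, ?_⟩) n
  · simpa using maximalIdeal_le hxy hqr hx'
  · simpa using self_mem_weightedMonomialIdeal ![x, y] ![q, r] 1

/-- **The filtration does not see `x`**: two regular systems `(x, y)`, `(x', y)` with the same `y` give the same
`(q, r)`-filtration (`q ≤ r`). [cite: AbramovichQuekSchober2025, Rem. 3.4] -/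
theorem eq_of_fst {x y x' : S} (hxy : Ideal.span {x, y} = maximalIdeal S) (hx'y : Ideal.span {x', y} = maximalIdeal S)
    {q r : ℕ} (hqr : q ≤ r) (n : ℕ) :
    weightedMonomialIdeal ![x', y] ![q, r] n = weightedMonomialIdeal ![x, y] ![q, r] n :=
  le_antisymm (le_of_fst_mem hxy hqr (hx'y ▸ Ideal.subset_span (by simp)) n)
    (le_of_fst_mem hx'y hqr (hxy ▸ Ideal.subset_span (by simp)) n)

omit [IsLocalRing S] in
/-- A unit factor on `y` does not change the filtration. [folklore] -/
theorem eq_of_snd_unit_mul (x y : S) {v : S} (hv : IsUnit v) (q r n : ℕ) :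
    weightedMonomialIdeal ![x, v * y] ![q, r] n = weightedMonomialIdeal ![x, y] ![q, r] n := by
  obtain ⟨v, rfl⟩ := hv
  have h1 : ((v : S) * y - y) ∈ weightedMonomialIdeal ![x, y] ![q, r] r := by
    have e : ((v : S) * y - y) = ((v : S) - 1) * y := by ring
    rw [e]
    refine Ideal.mul_mem_left _ _ ?_
    have := self_mem_weightedMonomialIdeal ![x, y] ![q, r] 1
    simpa using this
  have h2 : (y - (v : S) * y) ∈ weightedMonomialIdeal ![x, (v : S) * y] ![q, r] r := by
    have e : (y - (v : S) * y) = ((v⁻¹ : Sˣ) - 1 : S) * ((v : S) * y) := by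
      rw [sub_mul, one_mul, ← mul_assoc, Units.inv_mul, one_mul]
    rw [e]
    refine Ideal.mul_mem_left _ _ ?_
    have := self_mem_weightedMonomialIdeal ![x, (v : S) * y] ![q, r] 1
    simpa using this
  refine weightedMonomialIdeal_eq_of_forall_sub_mem ![x, y] ![x, (v : S) * y] ![q, r] ?_ ?_ n
  · intro i
    fin_cases i
    · simp
    · simpa using h1
  · intro i
    fin_cases i
    · simp
    · simpa using h2

/-- If `(x, y) = 𝔪`, `a` is a unit and `h ∈ 𝔪²`, then `(x, a y + h) = 𝔪`. [folklore] -/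
theorem span_pair_eq_of_unit_mul_add {x y a h : S} (hxy : Ideal.span {x, y} = maximalIdeal S) (ha : IsUnit a)
    (hh : h ∈ maximalIdeal S ^ 2) : Ideal.span {x, a * y + h} = maximalIdeal S := by
  have hx : x ∈ maximalIdeal S := hxy ▸ Ideal.subset_span (by simp)
  have hy : y ∈ maximalIdeal S := hxy ▸ Ideal.subset_span (by simp)
  -- `h = x m₁ + y m₂` with `m₁, m₂ ∈ 𝔪`
  have hh' : h ∈ Ideal.span {x} * maximalIdeal S ⊔ Ideal.span {y} * maximalIdeal S := by
    have e : maximalIdeal S ^ 2 = Ideal.span {x} * maximalIdeal S ⊔ Ideal.span {y} * maximalIdeal S := by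
      rw [pow_two, ← Ideal.sup_mul, ← Ideal.span_insert, hxy]
    rwa [e] at hh
  obtain ⟨h₁, hh₁, h₂, hh₂, rfl⟩ := Submodule.mem_sup.mp hh'
  obtain ⟨m₁, hm₁, rfl⟩ := Ideal.mem_span_singleton_mul.mp hh₁
  obtain ⟨m₂, hm₂, rfl⟩ := Ideal.mem_span_singleton_mul.mp hh₂
  have hunit : IsUnit (a + m₂) := by
    by_contra hnu
    have hmem : a + m₂ ∈ maximalIdeal S := (IsLocalRing.mem_maximalIdeal _).mpr hnu
    have : a ∈ maximalIdeal S := by simpa using Ideal.sub_mem _ hmem hm₂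
    exact (IsLocalRing.mem_maximalIdeal _).mp this ha
  obtain ⟨w, hw⟩ := hunit
  have hy' : a * y + (x * m₁ + y * m₂) = ↑w * y + m₁ * x := by rw [hw]; ring
  set y' : S := a * y + (x * m₁ + y * m₂) with hy'def
  apply le_antisymm
  · rw [Ideal.span_le, Set.insert_subset_iff, Set.singleton_subset_iff]
    exact ⟨hx, Ideal.add_mem _ (Ideal.mul_mem_left _ _ hy)
      (Ideal.add_mem _ (Ideal.mul_mem_right _ _ hx) (Ideal.mul_mem_right _ _ hy))⟩
  · rw [← hxy, Ideal.span_le, Set.insert_subset_iff, Set.singleton_subset_iff]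
    refine ⟨Ideal.subset_span (by simp), ?_⟩
    have hmem : ↑w⁻¹ * (y' - m₁ * x) ∈ Ideal.span {x, y'} :=
      Ideal.mul_mem_left _ _ (Ideal.sub_mem _ (Ideal.subset_span (by simp))
        (Ideal.mul_mem_left _ _ (Ideal.subset_span (by simp))))
    have heq : ↑w⁻¹ * (y' - m₁ * x) = y := by
      rw [hy', add_sub_cancel_right, Units.inv_mul_cancel_left]
    rw [heq] at hmem
    exact hmem

/-- **Substitution**: if `(x, y) = 𝔪`, `q ≤ r`, `a` is a unit, `h ∈ 𝔪^t` with `2 ≤ t` and `r ≤ q t`, then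
`y' = a y + h` defines the same `(q, r)`-filtration as `y` (the perturbation `h` has weight `≥ q t ≥ r`).
[cite: AbramovichQuekSchober2025, Thm 3.5 proof (c)] -/
theorem eq_of_snd_eq_unit_mul_add {x y a h : S} (hxy : Ideal.span {x, y} = maximalIdeal S) (ha : IsUnit a)
    {t : ℕ} (ht : 2 ≤ t) (hh : h ∈ maximalIdeal S ^ t) {q r : ℕ} (hqr : q ≤ r) (hrt : r ≤ q * t) (n : ℕ) :
    weightedMonomialIdeal ![x, a * y + h] ![q, r] n = weightedMonomialIdeal ![x, y] ![q, r] n := by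
  have hh2 : h ∈ maximalIdeal S ^ 2 := Ideal.pow_le_pow_right ht hh
  have hxy' : Ideal.span {x, a * y + h} = maximalIdeal S := span_pair_eq_of_unit_mul_add hxy ha hh2
  obtain ⟨a, rfl⟩ := ha
  -- `y' - y = (a - 1) y + h` and `y - y' = (a⁻¹ - 1) y' - a⁻¹ h`
  have h1 : ((a : S) * y + h - y) ∈ weightedMonomialIdeal ![x, y] ![q, r] r := by
    have e : ((a : S) * y + h - y) = ((a : S) - 1) * y + h := by ring
    rw [e]
    refine Ideal.add_mem _ (Ideal.mul_mem_left _ _ ?_) (mem_of_mem_maximalIdeal_pow hxy hqr hrt hh)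
    simpa using self_mem_weightedMonomialIdeal ![x, y] ![q, r] 1
  have h2 : (y - ((a : S) * y + h)) ∈ weightedMonomialIdeal ![x, (a : S) * y + h] ![q, r] r := by
    have e : (y - ((a : S) * y + h)) = ((a⁻¹ : Sˣ) - 1 : S) * ((a : S) * y + h) - ((a⁻¹ : Sˣ) : S) * h := by
      rw [sub_mul, one_mul, mul_add, ← mul_assoc, Units.inv_mul, one_mul]; ring
    rw [e]
    refine Ideal.sub_mem _ (Ideal.mul_mem_left _ _ ?_)
      (Ideal.mul_mem_left _ _ (mem_of_mem_maximalIdeal_pow hxy' hqr hrt hh))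
    simpa using self_mem_weightedMonomialIdeal ![x, (a : S) * y + h] ![q, r] 1
  refine weightedMonomialIdeal_eq_of_forall_sub_mem ![x, y] ![x, (a : S) * y + h] ![q, r] ?_ ?_ n
  · intro i
    fin_cases i
    · simp
    · simpa using h1
  · intro i
    fin_cases i
    · simp
    · simpa using h2

/-- **All weights `≤ W`**: `𝒥_{νW+1}(u; w) ⊆ 𝔪^{ν+1}` (a monomial of weight `> νW` has total degree `> ν`). Used for the
first clause of lex-maximality: an admissible `(y'; w'; ℓ')` has `ℓ' ≤ ν w'₀`. [cite: AbramovichQuekSchober2025, Def. 3.2] -/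
theorem le_pow_of_weights_le {x y : S} (hx : x ∈ maximalIdeal S) (hy : y ∈ maximalIdeal S) {q r W : ℕ}
    (hq : q ≤ W) (hr : r ≤ W) (ν : ℕ) :
    weightedMonomialIdeal ![x, y] ![q, r] (ν * W + 1) ≤ maximalIdeal S ^ (ν + 1) := by
  refine weightedMonomialIdeal_two_le fun i j hij => ?_
  have hdeg : ν + 1 ≤ i + j := by
    by_contra hlt
    push Not at hlt
    have : q * i + r * j ≤ W * (i + j) := by nlinarith
    have : W * (i + j) ≤ W * ν := Nat.mul_le_mul_left _ (by omega)
    nlinarith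
  have hmem : x ^ i * y ^ j ∈ maximalIdeal S ^ (i + j) := by
    rw [pow_add]; exact Ideal.mul_mem_mul (Ideal.pow_mem_pow hx i) (Ideal.pow_mem_pow hy j)
  exact Ideal.pow_le_pow_right hdeg hmem

omit [IsLocalRing S] in
/-- **Above an integer level**: if `b q' < r'` (slope `r'/q' > b`) then
`𝒥_{r'ν}((x, y'); (q', r')) ⊆ (y'^ν) + 𝒥_{bν+1}((x, y'); (1, b))` — every monomial not divisible by `y'^ν` is strictly above the
`(1, b)`-face. With `b = 1` the right-hand side is `(y'^ν) + 𝔪^{ν+1}` (`le_span_pow_sup_pow`).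
[cite: AbramovichQuekSchober2025, Def. 3.2–3.3] -/
theorem le_span_pow_sup_of_lt (x y' : S) {q' r' b : ℕ} (hb : b * q' < r') (ν : ℕ) :
    weightedMonomialIdeal ![x, y'] ![q', r'] (r' * ν) ≤
      Ideal.span {y' ^ ν} ⊔ weightedMonomialIdeal ![x, y'] ![1, b] (b * ν + 1) := by
  refine weightedMonomialIdeal_two_le fun i j hij => ?_
  by_cases hj : ν ≤ j
  · obtain ⟨d, rfl⟩ := Nat.exists_eq_add_of_le hj
    refine Ideal.mem_sup_left ?_
    rw [pow_add, mul_comm (y' ^ ν), ← mul_assoc]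
    exact Ideal.mul_mem_left _ _ (Ideal.mem_span_singleton_self _)
  · push Not at hj
    refine Ideal.mem_sup_right (monomial_mem x y' 1 b ?_)
    -- `q' i ≥ r'(ν - j) > b q' (ν - j)` forces `i ≥ b(ν - j) + 1`
    obtain ⟨d, rfl⟩ := Nat.exists_eq_add_of_lt hj
    have h1 : q' * i ≥ r' * (d + 1) := by nlinarith
    have h2 : r' * (d + 1) ≥ (b * q' + 1) * (d + 1) := Nat.mul_le_mul_right _ hb
    have h3 : q' * i > q' * (b * (d + 1)) := by nlinarith
    have h4 : b * (d + 1) < i := Nat.lt_of_mul_lt_mul_left h3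
    nlinarith

/-- The case `b = 1`: slope `> 1` puts everything but `y'^ν` into `𝔪^{ν+1}` — the tangent cone of `f ∈ 𝒥_{r'ν}` is the
`ν`-fold line `ȳ' = 0`. [cite: AbramovichQuekSchober2025, §2 (δ > 1)] -/
theorem le_span_pow_sup_pow {x y' : S} (hxy' : Ideal.span {x, y'} = maximalIdeal S) {q' r' : ℕ}
    (hlt : q' < r') (ν : ℕ) :
    weightedMonomialIdeal ![x, y'] ![q', r'] (r' * ν) ≤ Ideal.span {y' ^ ν} ⊔ maximalIdeal S ^ (ν + 1) := by
  have h := le_span_pow_sup_of_lt x y' (b := 1) (by simpa using hlt) ν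
  rwa [LocalGameEFTSteepening.weightedMonomialIdeal_one_eq_pow, hxy', one_mul] at h

/-- From `f ∈ (y'^ν) + 𝔪^{ν+1}` and `f ∉ 𝔪^{ν+1}`: `f = c y'^ν + m` with `c` a UNIT and `m ∈ 𝔪^{ν+1}`. [folklore] -/
theorem exists_unit_mul_pow_add {y' f : S} (hy' : y' ∈ maximalIdeal S) {ν : ℕ}
    (hf : f ∈ Ideal.span {y' ^ ν} ⊔ maximalIdeal S ^ (ν + 1)) (hford : f ∉ maximalIdeal S ^ (ν + 1)) :
    ∃ c m : S, IsUnit c ∧ m ∈ maximalIdeal S ^ (ν + 1) ∧ f = c * y' ^ ν + m := by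
  obtain ⟨a, ha, m, hm, rfl⟩ := Submodule.mem_sup.mp hf
  obtain ⟨c, rfl⟩ := Ideal.mem_span_singleton'.mp ha
  refine ⟨c, m, ?_, hm, rfl⟩
  by_contra hc
  apply hford
  refine Ideal.add_mem _ ?_ hm
  rw [pow_succ']
  exact Ideal.mul_mem_mul ((IsLocalRing.mem_maximalIdeal _).mpr hc) (Ideal.pow_mem_pow hy' ν)

/-! ### Reading modulo `(y)`: ceiling bookkeeping -/

omit [IsLocalRing S] in
/-- `a ≤ q i ⇒ ⌈a/q⌉ ≤ i`. [folklore] -/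
theorem cdiv_le_of_le_mul {a q i : ℕ} (hq : 0 < q) (h : a ≤ q * i) : (a + q - 1) / q ≤ i := by
  rw [Nat.div_le_iff_le_mul_add_pred hq]
  omega

/-- **Modulo `(y)` only the `x`-axis survives**: `𝒥ₙ((x, y); (q, r)) ⊆ (y) + 𝔪^⌈n/q⌉` (`q ≥ 1`, `x ∈ 𝔪`).
[cite: AbramovichQuekSchober2025, Def. 3.2] -/
theorem le_span_sup_pow_cdiv {x : S} (hx : x ∈ maximalIdeal S) (y : S) {q : ℕ} (hq : 0 < q) (r n : ℕ) :
    weightedMonomialIdeal ![x, y] ![q, r] n ≤ Ideal.span {y} ⊔ maximalIdeal S ^ ((n + q - 1) / q) := by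
  refine weightedMonomialIdeal_two_le fun i j hij => ?_
  rcases Nat.eq_zero_or_pos j with rfl | hj
  · refine Ideal.mem_sup_right ?_
    rw [pow_zero, mul_one]
    exact Ideal.pow_le_pow_right (cdiv_le_of_le_mul hq (by simpa using hij)) (Ideal.pow_mem_pow hx i)
  · refine Ideal.mem_sup_left (Ideal.mul_mem_left _ _ ?_)
    obtain ⟨d, rfl⟩ := Nat.exists_eq_add_of_le hj
    rw [pow_add, pow_one]
    exact Ideal.mul_mem_right _ _ (Ideal.mem_span_singleton_self y)

/-- **The lower pieces**: `𝒥_{r'ν}((x, y'); (q', r')) ⊆ (y'^ν) + ⨆_{j<ν} (y'^j) 𝔪^⌈r'(ν-j)/q'⌉` (`q' ≥ 1`, `x ∈ 𝔪`).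
[cite: AbramovichQuekSchober2025, Def. 3.2] -/
theorem le_span_pow_sup_iSup {x : S} (hx : x ∈ maximalIdeal S) (y' : S) {q' : ℕ} (hq' : 0 < q') (r' ν : ℕ) :
    weightedMonomialIdeal ![x, y'] ![q', r'] (r' * ν) ≤
      Ideal.span {y' ^ ν} ⊔ ⨆ j, ⨆ (_ : j < ν), Ideal.span {y' ^ j} * maximalIdeal S ^ ((r' * (ν - j) + q' - 1) / q') := by
  refine weightedMonomialIdeal_two_le fun i j hij => ?_
  by_cases hj : ν ≤ j
  · obtain ⟨d, rfl⟩ := Nat.exists_eq_add_of_le hj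
    refine Ideal.mem_sup_left ?_
    rw [pow_add, mul_comm (y' ^ ν), ← mul_assoc]
    exact Ideal.mul_mem_left _ _ (Ideal.mem_span_singleton_self _)
  · push Not at hj
    refine Ideal.mem_sup_right ?_
    refine (le_iSup (fun j => ⨆ (_ : j < ν), Ideal.span {y' ^ j} * maximalIdeal S ^ ((r' * (ν - j) + q' - 1) / q')) j)
      ((le_iSup (fun _ : j < ν => Ideal.span {y' ^ j} * maximalIdeal S ^ ((r' * (ν - j) + q' - 1) / q')) hj) ?_)
    rw [mul_comm (x ^ i)]
    refine Ideal.mul_mem_mul (Ideal.mem_span_singleton_self _) (Ideal.pow_le_pow_right ?_ (Ideal.pow_mem_pow hx i))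
    refine cdiv_le_of_le_mul hq' ?_
    have : r' * (ν - j) + r' * j = r' * ν := by rw [← Nat.mul_add, Nat.sub_add_cancel hj.le]
    omega

end Local

/-! ### Slope monotonicity and the swap of the two variables -/

/-- **Slope monotonicity at the `y^ν` corner**: if `r'/q' ≤ r/q` (`q, q' ≥ 1`) then
`𝒥_{rν}((x,y);(q,r)) ⊆ 𝒥_{r'ν}((x,y);(q',r'))`. [cite: AbramovichQuekSchober2025, Rem. 3.4] -/
theorem slope_antitone (x y : S) {q r q' r' : ℕ} (hq : 0 < q) (h : r' * q ≤ r * q') (ν : ℕ) :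
    weightedMonomialIdeal ![x, y] ![q, r] (r * ν) ≤ weightedMonomialIdeal ![x, y] ![q', r'] (r' * ν) := by
  refine weightedMonomialIdeal_two_le fun i j hij => monomial_mem x y q' r' ?_
  by_cases hj : ν ≤ j
  · nlinarith
  · push Not at hj
    -- `q i ≥ r (ν - j)` ⇒ `q q' i ≥ r q' (ν - j) ≥ r' q (ν - j)` ⇒ `q' i ≥ r' (ν - j)`
    obtain ⟨d, rfl⟩ := Nat.exists_eq_add_of_lt hj
    have h1 : q * i ≥ r * (d + 1) := by nlinarith
    have h2 : q * (q' * i) ≥ q * (r' * (d + 1)) := by nlinarith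
    have h3 : q' * i ≥ r' * (d + 1) := le_of_mul_le_mul_left h2 hq
    nlinarith

/-- **Swap**: `𝒥ₙ(![a, b]; ![wa, wb]) = 𝒥ₙ(![b, a]; ![wb, wa])` (the predicate `IsLexMaxWeightedCentreGerm` lists the
ORDER variable first). [folklore] -/
theorem weightedMonomialIdeal_swap (a b : S) (wa wb n : ℕ) :
    weightedMonomialIdeal ![a, b] ![wa, wb] n = weightedMonomialIdeal ![b, a] ![wb, wa] n := by
  apply le_antisymm
  · refine weightedMonomialIdeal_two_le fun i j hij => ?_
    rw [mul_comm]
    exact monomial_mem b a wb wa (by omega)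
  · refine weightedMonomialIdeal_two_le fun i j hij => ?_
    rw [mul_comm]
    exact monomial_mem a b wa wb (by omega)

end AQSHeightTwo

end Summit.ResolutionOfSingularities.ResolutionOfSingularities.Theorems

end
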